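import Literature.Analysis.FluidPDE.TorusClassicalNSTimeDerivLinearised
import Summits.AnomalousDissipation.AnomalousDissipation.Theorems.BaireTransferDenseLoudDesignerForcesErgodicLine

/-!
# The flow direction solves the linearised equation (tools stub `stub_timeDerivLinearisedTools`, block N-A,
# line `ergodic-budget-selection-closing`, crux `BaireTransfer.DenseLoudDesignerForces`, stmt-AnomalousDissipation-1143)

Summit-side specialisation to `T³ = UnitAddTorus (Fin 3)` of the Literature theorem
`Torus.IsClassicalNSSolutionOn.timeDerivWithin_isLinearised_of_steady`
(`Literature/Analysis/FluidPDE/TorusClassicalNSTimeDerivLinearised.lean`), read in the line vocabulary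
`IsLinearizedNSSolutionOn` (`…ErgodicLine.lean`): for a classical solution `(u, p)` of NS_ν on `[a, b] × T³`,
`a < b`, driven by a STEADY force `F` and with mean-zero velocity slices, the one-sided time derivatives
`w = ∂ₜu = Torus.timeDerivWithin (Icc a b) u` and `q = ∂ₜp` form a solution of the linearised Navier–Stokes
equation along `u` on `[a, b]`: `w, q` jointly smooth, `div w = 0`, `∫ w = 0`, and
`∂ₜw + (u·∇)w + (w·∇)u = νΔw − ∇q` (differentiate the momentum equation in time; the steady force drops out).
This is the fact "the flow direction `∂ₜu` is a vector of the derivative cocycle" used by the hyperbolicity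
clause `IsHyperbolicMeasure` (the zero exponent of the flow direction) and by block N-A of the line.  The
registered tools stub `stub_timeDerivLinearisedTools` is proved BY NAME with exactly the registered signature.

References: R. Temam, *Navier–Stokes Equations and Nonlinear Functional Analysis* (2nd ed., SIAM 1995) Part I
§3.4, (3.39); P. Constantin, C. Foias, *Navier–Stokes Equations* (1988) Ch. 10.
-/

-- `Summit.<Summit>.<Problem>` is the tree's mandated summit-side namespace (CONVENTIONS §2); for this
-- single-conjunct summit the two coincide, so the duplicate is deliberate.
set_option linter.dupNamespace false

noncomputable section

open scoped BigOperators Topology ENNReal InnerProductSpace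
open Filter Set Function MeasureTheory

namespace Summit.AnomalousDissipation.AnomalousDissipation.Theorems.DenseLoudDesignerForces.Ergodic

open Literature.Analysis.FunctionSpaces Literature.Analysis.FunctionSpaces.Torus
open Literature.Analysis.FluidPDE Literature.Analysis.FluidPDE.Torus

/-- **Tools stub of block N-A (`stub_timeDerivLinearisedTools`, crux stmt-AnomalousDissipation-1143, line
`ergodic-budget-selection-closing`) — `∂ₜu` solves the linearised equation (steady force).**  For a classical
solution `(u, p)` of NS_ν on `[a, b] × T³` (`a < b`) with the steady force `F` and mean-zero velocity slices,
`(∂ₜu, ∂ₜp)` (one-sided time derivatives within `[a, b]`) is a solution of the linearised Navier–Stokes equation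
along `u` on `[a, b]` in the sense of `IsLinearizedNSSolutionOn`: jointly smooth, divergence free, mean zero, and
`∂ₜ(∂ₜu) + (u·∇)∂ₜu + (∂ₜu·∇)u = νΔ∂ₜu − ∇∂ₜp`
(`Torus.IsClassicalNSSolutionOn.timeDerivWithin_isLinearised_of_steady` at `d = Fin 3`). [cite: ConstantinFoiasNSE1988, Ch. 10] -/
theorem stub_timeDerivLinearisedTools {ν a b : ℝ} (hab : a < b) {F : (UnitAddTorus (Fin 3)) → (EuclideanSpace ℝ (Fin 3))}
    {u : ℝ → (UnitAddTorus (Fin 3)) → (EuclideanSpace ℝ (Fin 3))} {p : ℝ → (UnitAddTorus (Fin 3)) → ℝ}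
    (h : IsClassicalNSSolutionOn (Icc a b) ν (fun _ => F) u p) (hmean : ∀ t ∈ Icc a b, HasZeroMean (u t)) :
    IsLinearizedNSSolutionOn (Icc a b) ν u (Torus.timeDerivWithin (Icc a b) u) (Torus.timeDerivWithin (Icc a b) p) :=
  h.timeDerivWithin_isLinearised_of_steady hab hmean

end Summit.AnomalousDissipation.AnomalousDissipation.Theorems.DenseLoudDesignerForces.Ergodic

end
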